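import Summits.KontsevichZagierPeriods.KontsevichZagierPeriods.Theses.FurushoPentagon
import Literature.NumberTheory.Transcendental.DrinfeldAssociatorRegularisation
import Literature.NumberTheory.Transcendental.KZCalculus
import Literature.NumberTheory.Transcendental.SemialgebraicMaps

/-!
# `PentagonInKZ` (stmt-KontsevichZagierPeriods-11348), line `edge-normal-newton-leibniz`:
# stub `stub_cornersBlowup` — the dilation move on ordered simplices (aux)

The side `η = 1/2` of the two blow-up corner charts of the pentagon cell is read on the open
ordered simplex of side `1` with poles `0, 2, -2`, while the fifteen-path atlas reads the same
iterated integrals (paths `1`, `3`) on the simplex of side `1/2` with poles `0, 1, -1`.  The bridge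
is ONE change of variables of the Kontsevich–Zagier calculus (rule (2)) per word, the dilation
`t = κ t'` (`κ ∈ ℚ_{>0}`): `of_sub_of_mem_relations_of_dilation` (product representations whose
letter densities correspond under `t ↦ κ t`), and its consequence for the end-regularised
pairings of two families of simplex integrals with poles `σ` and `κ σ`
(`pair_regEnd_eq_of_dilation`).  Also filed here: the three scalar identities between the letter
densities of the blow-up charts on the open chart `(0,1) × (0,1/2)` (`scalar_B`, pure
real arithmetic).

References: [KontsevichZagier2001, §1.2 rule (2)], [Drinfeld1991, §2].
-/

noncomputable section

open Literature.NumberTheory.Transcendental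

namespace Summit.KontsevichZagierPeriods.FurushoPentagon.PentagonInKZ

namespace CornersBlowup

open Set MvPolynomial

/-- The dilation `t ↦ κ t` maps the open ordered simplex of side `β` onto the one of side `κ β`
(`κ > 0`). [folklore] -/
theorem image_smul_simplex {n : ℕ} {κ : ℝ} (hκ : 0 < κ) (β : ℝ) :
    (fun t : Fin n → ℝ => κ • t) '' {t | (∀ i, 0 < t i ∧ t i < β) ∧ StrictAnti t} =
      {t | (∀ i, 0 < t i ∧ t i < κ * β) ∧ StrictAnti t} := by
  ext t
  constructor
  · rintro ⟨s, ⟨hs, hanti⟩, rfl⟩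
    refine ⟨fun i => ⟨?_, ?_⟩, fun i j hij => ?_⟩
    · simp only [Pi.smul_apply, smul_eq_mul]; exact mul_pos hκ (hs i).1
    · simp only [Pi.smul_apply, smul_eq_mul]; exact mul_lt_mul_of_pos_left (hs i).2 hκ
    · simp only [Pi.smul_apply, smul_eq_mul]; exact mul_lt_mul_of_pos_left (hanti hij) hκ
  · rintro ⟨ht, hanti⟩
    refine ⟨κ⁻¹ • t, ⟨fun i => ⟨?_, ?_⟩, fun i j hij => ?_⟩, ?_⟩
    · simp only [Pi.smul_apply, smul_eq_mul]; exact mul_pos (inv_pos.2 hκ) (ht i).1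
    · simp only [Pi.smul_apply, smul_eq_mul]
      rw [inv_mul_lt_iff₀ hκ]
      exact (ht i).2
    · simp only [Pi.smul_apply, smul_eq_mul]
      exact mul_lt_mul_of_pos_left (hanti hij) (inv_pos.2 hκ)
    · exact smul_inv_smul₀ hκ.ne' t

/-- **The dilation move on ordered simplices** (one change of variables, Kontsevich–Zagier's
rule (2)): two product representations over the open ordered simplices of sides `β` and
`β' = κ β` (`κ ∈ ℚ_{>0}`) whose letter densities correspond under `t ↦ κ t`
(`d i s = κ · d' i (κ s)` on `(0, β)`) have the same class modulo relations — the witness is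
`Φ = κ • id`, `|det Φ'| = κⁿ`. [cite: KontsevichZagier2001, §1.2 rule (2)] -/
theorem of_sub_of_mem_relations_of_dilation {n : ℕ} (κ : ℚ) (hκ : 0 < κ)
    (r r' : KZ.IntegralRep n) (β β' : ℝ) (hβ' : β' = (κ : ℝ) * β) (d d' : Fin n → ℝ → ℝ)
    (hr : r.domain = {t | (∀ i, 0 < t i ∧ t i < β) ∧ StrictAnti t} ∧
      Set.EqOn r.integrand (fun t => ∏ i, d i (t i)) r.domain)
    (hr' : r'.domain = {t | (∀ i, 0 < t i ∧ t i < β') ∧ StrictAnti t} ∧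
      Set.EqOn r'.integrand (fun t => ∏ i, d' i (t i)) r'.domain)
    (hdd' : ∀ i s, 0 < s → s < β → d i s = (κ : ℝ) * d' i ((κ : ℝ) * s)) :
    KZ.of r - KZ.of r' ∈ KZ.relations := by
  subst hβ'
  have hκr : (0 : ℝ) < κ := by exact_mod_cast hκ
  refine KZ.changeOfVariablesRel_subset_relations ⟨n, r, r', fun t => (κ : ℝ) • t,
    fun _ => (κ : ℝ) • ContinuousLinearMap.id ℝ (Fin n → ℝ), ?_, ?_, ?_, ?_, ?_, rfl⟩
  · -- a `ℚ`-polynomial map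
    refine (isSemialgebraicMapOn_aeval r.isSemialgebraic_domain
      fun j : Fin n => MvPolynomial.C κ * X j).congr fun x _ => ?_
    funext j
    simp
  · intro x _
    exact ((hasFDerivAt_id x).const_smul (κ : ℝ)).hasFDerivWithinAt
  · exact (smul_right_injective (Fin n → ℝ) hκr.ne').injOn
  · rw [hr'.1, hr.1, image_smul_simplex hκr]
  · intro x hx
    have hx' : (κ : ℝ) • x ∈ r'.domain := by
      rw [hr'.1, ← image_smul_simplex hκr]
      rw [hr.1] at hx
      exact Set.mem_image_of_mem _ hx
    rw [hr.2 hx, hr'.2 hx']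
    have hdet : ((κ : ℝ) • ContinuousLinearMap.id ℝ (Fin n → ℝ)).det = (κ : ℝ) ^ n := by
      rw [ContinuousLinearMap.det, ContinuousLinearMap.toLinearMap_smul, LinearMap.det_smul,
        Module.finrank_fin_fun]
      simp
    rw [hdet, abs_of_pos (pow_pos hκr n), ← Fin.prod_const, ← Finset.prod_mul_distrib]
    rw [hr.1] at hx
    refine Finset.prod_congr rfl fun i _ => ?_
    rw [hdd' i (x i) (hx.1 i).1 (hx.1 i).2, mul_comm]
    rfl

/-- **Rescaling a family of simplex integrals**: for two families of product representations
`Ia` (side `β`, poles `σ`) and `Ia'` (side `κ β`, poles `κ σ`) over the same alphabet, the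
end-regularised pairings agree (`1/(s - σ) = κ/(κ s - κ σ)`; word by word one dilation move).
[cite: KontsevichZagier2001, §1.2 rule (2)] -/
theorem pair_regEnd_eq_of_dilation {R : Type} [CommRing R] [Algebra ℚ R]
    (χ : KZ.FormalRep →+ R) (hrel : ∀ c ∈ KZ.relations, χ c = 0) {K : Type} [DecidableEq K]
    (κ : ℚ) (hκ : 0 < κ) (β β' : ℝ) (hβ' : β' = (κ : ℝ) * β) (σ σ' : K → ℝ)
    (hσ' : ∀ b, σ' b = (κ : ℝ) * σ b) (y : K)
    (Ia : (w : List K) → KZ.IntegralRep w.length)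
    (hIa : ∀ w : List K, w.getLast? ≠ some y →
      (Ia w).domain = {t | (∀ i, 0 < t i ∧ t i < β) ∧ StrictAnti t} ∧
      Set.EqOn (Ia w).integrand (fun t => ∏ i, 1 / (t i - σ (w.get i))) (Ia w).domain)
    (Ia' : (w : List K) → KZ.IntegralRep w.length)
    (hIa' : ∀ w : List K, w.getLast? ≠ some y →
      (Ia' w).domain = {t | (∀ i, 0 < t i ∧ t i < β') ∧ StrictAnti t} ∧
      Set.EqOn (Ia' w).integrand (fun t => ∏ i, 1 / (t i - σ' (w.get i))) (Ia' w).domain)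
    (W : List K) :
    Shuffle.pair (fun w => χ (KZ.of (Ia' w))) (Shuffle.regEnd y W) =
      Shuffle.pair (fun w => χ (KZ.of (Ia w))) (Shuffle.regEnd y W) := by
  refine Shuffle.pair_congr fun u hu => ?_
  have hu' := Shuffle.getLast?_ne_of_mem_support_regEnd y W hu
  have hκr : (κ : ℝ) ≠ 0 := by exact_mod_cast hκ.ne'
  have hsub := of_sub_of_mem_relations_of_dilation κ hκ (Ia u) (Ia' u) β β' hβ'
    (fun i s => 1 / (s - σ (u.get i))) (fun i s => 1 / (s - σ' (u.get i))) (hIa u hu')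
    (hIa' u hu') (fun i s _ _ => by
      simp only [hσ']
      rw [show (κ : ℝ) * s - (κ : ℝ) * σ (u.get i) = (κ : ℝ) * (s - σ (u.get i)) by ring,
        mul_one_div, div_mul_eq_div_div, div_self hκr])
  have := hrel _ hsub
  rw [map_sub, sub_eq_zero] at this
  exact this.symm


/-- The two scalar identities of the blow-up charts' densities on the open chart
`(0,1) × (0,1/2)`, and the vanishing pattern. [folklore] -/
theorem scalar_B (f g : Fin 5 → ℝ → ℝ → ℝ)
    (hfg : ∀ x y : ℝ, (f 0 x y = 1 / x ∧ f 1 x y = 0 ∧ f 2 x y = -y / (1 - x * y) ∧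
      f 3 x y = 0 ∧ f 4 x y = (1 - y) / (1 + x - x * y)) ∧ (g 0 x y = 0 ∧ g 1 x y = 1 / y ∧
      g 2 x y = -x / (1 - x * y) ∧ g 3 x y = -1 / (1 - y) ∧ g 4 x y = -x / (1 + x - x * y)))
    (x y : ℝ) (hx0 : 0 < x) (hx1 : x < ((1 : ℚ) : ℝ)) (hy0 : 0 < y)
    (hy1 : y < ((1 / 2 : ℚ) : ℝ)) :
    f 0 x y * g 2 x y = f 2 x y * g 1 x y ∧ f 0 x y * g 4 x y = f 4 x y * g 3 x y ∧
      f 4 x y * g 2 x y = f 2 x y * g 1 x y + f 2 x y * g 4 x y - f 4 x y * g 3 x y := by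
  obtain ⟨⟨a0, -, a2, -, a4⟩, -, b1, b2, b3, b4⟩ := hfg x y
  have hx1' : x < 1 := by simpa using hx1
  have hy1' : y < 1 / 2 := by simpa using hy1
  have hx : x ≠ 0 := hx0.ne'
  have hy : y ≠ 0 := hy0.ne'
  have h1y : 1 - y ≠ 0 := by intro h; linarith
  have hxy : 1 - x * y ≠ 0 := by nlinarith [mul_lt_mul'' hx1' hy1' hx0.le hy0.le]
  have hden : 1 + x - x * y ≠ 0 := by nlinarith [mul_pos hx0 (by linarith : (0:ℝ) < 1 - y)]
  refine ⟨?_, ?_, ?_⟩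
  · rw [a0, b2, a2, b1]; field_simp
  · rw [a0, b4, a4, b3]; field_simp
  · rw [a4, b2, a2, b1, b4, b3, div_mul_div_comm, div_mul_div_comm, div_mul_div_comm,
      div_mul_div_comm, div_add_div _ _ (mul_ne_zero hxy hy) (mul_ne_zero hxy hden),
      div_sub_div _ _ (mul_ne_zero (mul_ne_zero hxy hy) (mul_ne_zero hxy hden))
        (mul_ne_zero hden h1y),
      div_eq_div_iff (mul_ne_zero hden hxy)
        (mul_ne_zero (mul_ne_zero (mul_ne_zero hxy hy) (mul_ne_zero hxy hden))
          (mul_ne_zero hden h1y))]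
    ring

end CornersBlowup

/-- **Sub-stub `cornersBlowup_dilation` of `stub_cornersBlowup`**: THE DILATION MOVE — two
product representations over the open ordered simplices of sides `β` and `κ β` (`κ ∈ ℚ_{>0}`)
whose letter densities correspond under `t ↦ κ t` (`d i s = κ · d' i (κ s)` on `(0, β)`) differ
by Kontsevich–Zagier relations (one change of variables `Φ = κ • id`, `|det Φ'| = κⁿ`).
[cite: KontsevichZagier2001, §1.2 rule (2)] -/
theorem cornersBlowup_dilation :
    ∀ (n : ℕ) (κ : ℚ), 0 < κ → ∀ (r r' : KZ.IntegralRep n) (β β' : ℝ), β' = (κ : ℝ) * β → ∀ (d d' : Fin n → ℝ → ℝ), (r.domain = {t | (∀ i, 0 < t i ∧ t i < β) ∧ StrictAnti t} ∧ Set.EqOn r.integrand (fun t => ∏ i, d i (t i)) r.domain) → (r'.domain = {t | (∀ i, 0 < t i ∧ t i < β') ∧ StrictAnti t} ∧ Set.EqOn r'.integrand (fun t => ∏ i, d' i (t i)) r'.domain) → (∀ (i : Fin n) (s : ℝ), 0 < s → s < β → d i s = (κ : ℝ) * d' i ((κ : ℝ) * s)) → KZ.of r - KZ.of r' ∈ KZ.relations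 := by
  intro n κ hκ r r' β β' hβ' d d' hr hr' hdd'
  exact CornersBlowup.of_sub_of_mem_relations_of_dilation κ hκ r r' β β' hβ' d d' hr hr' hdd'

end Summit.KontsevichZagierPeriods.FurushoPentagon.PentagonInKZ
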